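import Summits.AtomisticToContinuum.Crystallization.Theorems.ChargedEnergyGap.Negative.BlocksBound
import Summits.AtomisticToContinuum.Crystallization.Theorems.ThreeConeCertificateOnePercentCertificateFccRung
import Summits.AtomisticToContinuum.Crystallization.Theorems.ExcessDecayLiouvilleFarField
import Summits.AtomisticToContinuum.Crystallization.Theorems.HullExactificationCascadeHullBulkOptimalCut
import Literature.MathematicalPhysics.StatisticalMechanics.LocalMatchingCompactness

/-!
# Cohesion of uniformly bound Lennard-Jones configurations, I: separation and touching balls

Helper file (`--supports stmt-AtomisticToContinuum-15099`) of the stub `stub_cohesion` of the line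
`registered` (skeleton `Cruxes/UniformBindingRigidity/Lines/birth.lean`) of the crux
`Summit.AtomisticToContinuum.Crystallization.Theses.PerronTransitivity.UniformBindingRigidity`
(item stmt-AtomisticToContinuum-15099, route `PerronTransitivity`).  The stub (COHESION) says: a
non-empty uniformly discrete `X ⊆ ℝ³` every site `p` of which has Lennard-Jones site sum
`U_X(p) = Σ'_{q ∈ X, q ≠ p} V_LJ(dist p q) ≤ 2e*`, `e* = ⨅_Q e_LJ(Q)` over periodic configurations,
is relatively dense (`∃ R, ∀ y, ∃ p ∈ X, dist y p ≤ R`).  Part I (this file) and part II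
(`…CohesionB.lean`) mechanise the soft part of the stub and isolate its hard core as one finite,
local, multi-site surface estimate.  Here:

* §1 `two_mul_iInf_le` — `2e* ≤ −711/500 < 0` (tree: `OnePercentFccRung.eStar_le_neg`).
* §2 site sums of a `δ`-separated set: summable (`summable_site`), sixth-power sum `≤ 1024/δ⁶`
  (`tsum_inv_pow_six_site_le`, dyadic shells of the tree), and the one-neighbour repulsion bound
  `(1/12)(dist p q)⁻¹² − (1/6)·1024/δ⁶ ≤ U_X(p)` (`repulsion_sub_le_tsum_site`).
* §3 **absolute separation** (`quarter_le_dist`): a uniformly discrete `X` with all site sums `≤ 0`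
  (e.g. uniformly `2e*`-bound) is `1/4`-separated, WHATEVER its own separation constant — an
  infimum-of-distances bootstrap in one step: the packing bound at scale `m = inf dist` is scale
  invariant, and the repulsion `r⁻¹²/12` at a pair with `dist < 2^{1/12} m` beats the total
  attraction `1024 m⁻⁶/6` as soon as `4096 m⁶ < 1`.
* §4 nearest points of separated sets exist (`exists_forall_dist_le`); a set that is not relatively
  dense has touching empty balls of every radius (`exists_touching`).

All `[folklore]`.
-/

noncomputable section

namespace Summit.AtomisticToContinuum.Crystallization.Theorems.PerronTransitivityUniformBindingRigidity

open scoped BigOperators Topology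
open Filter Set Metric
open Literature.MathematicalPhysics.StatisticalMechanics
open Summit.AtomisticToContinuum.Crystallization.Theorems.ChargedEnergyGapNegative (E3 eStar eStar_le)
open Summit.AtomisticToContinuum.Crystallization.Theorems.ExcessDecayLiouville
  (summable_inv_pow_of_separated tsum_inv_pow_le_of_separated)
open Summit.AtomisticToContinuum.Crystallization.Theorems.HullBulkOptimal
  (summable_lennardJones_site abs_lennardJones_le tsum_finite_eq_sum)

/-! ## §1 The level `2e*` is negative -/

/-- `2 e* ≤ −711/500`: twice the tree's certified rung `e* ≤ −0.711`
(`OnePercentFccRung.eStar_le_neg`, fcc at nearest-neighbour distance `√(19/20)`, twenty shells). [folklore] -/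
theorem two_mul_iInf_le :
    2 * (⨅ Q : PeriodicConfiguration 3, Q.energyPerParticle lennardJones) ≤ -(711 / 500) := by
  have h : eStar ≤ -(711 / 1000) := OnePercentFccRung.eStar_le_neg
  unfold eStar at h
  linarith

/-- In particular `2 e* < 0`. [folklore] -/
theorem two_mul_iInf_lt_zero :
    2 * (⨅ Q : PeriodicConfiguration 3, Q.energyPerParticle lennardJones) < 0 :=
  two_mul_iInf_le.trans_lt (by norm_num)

/-! ## §2 Site sums of a separated set -/

section SiteSums

variable {X : Set E3} {δ : ℝ}

/-- For a `δ`-separated `X ∋ p` (`δ > 0`) the index sets `{q ∈ X : q ≠ p}` and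
`{q ∈ X : δ ≤ dist q p}` coincide. [folklore] -/
theorem setOf_ne_eq_setOf_le_dist (hδ : 0 < δ) (hsep : ∀ a ∈ X, ∀ b ∈ X, a ≠ b → δ ≤ dist a b)
    {p : E3} (hp : p ∈ X) :
    ({q : E3 | q ∈ X ∧ q ≠ p} : Set E3) = {q : E3 | q ∈ X ∧ δ ≤ dist q p} := by
  ext q
  simp only [mem_setOf_eq]
  constructor
  · rintro ⟨hq, hne⟩
    exact ⟨hq, hsep q hq p hp hne⟩
  · rintro ⟨hq, hd⟩
    refine ⟨hq, fun h => ?_⟩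
    rw [h, dist_self] at hd
    linarith

/-- **Summability of the site family.** For a `δ`-separated `X ⊆ ℝ³` and `p ∈ X`, the family
`q ↦ V_LJ(dist p q)` over `{q ∈ X : q ≠ p}` is summable (tree: `summable_lennardJones_site`).
[folklore] -/
theorem summable_site (hδ : 0 < δ) (hsep : ∀ a ∈ X, ∀ b ∈ X, a ≠ b → δ ≤ dist a b)
    {p : E3} (hp : p ∈ X) :
    Summable fun q : {q : E3 // q ∈ X ∧ q ≠ p} => lennardJones (dist p q.1) :=
  summable_lennardJones_site hδ hsep hp

/-- Summability of the sixth-power family `q ↦ (dist p q)⁻⁶` over `{q ∈ X : q ≠ p}`. [folklore] -/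
theorem summable_inv_pow_six_site (hδ : 0 < δ) (hsep : ∀ a ∈ X, ∀ b ∈ X, a ≠ b → δ ≤ dist a b)
    {p : E3} (hp : p ∈ X) :
    Summable fun q : {q : E3 // q ∈ X ∧ q ≠ p} => (dist p q.1)⁻¹ ^ 6 := by
  have h := summable_inv_pow_of_separated (X := X) p (k := 3) (by norm_num) hδ le_rfl hsep
  have hset := setOf_ne_eq_setOf_le_dist hδ hsep hp
  show Summable fun q : ↥({q : E3 | q ∈ X ∧ q ≠ p} : Set E3) => (dist p (q : E3))⁻¹ ^ 6
  rw [hset]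
  refine h.congr fun q => ?_
  simp [dist_comm]

/-- The sixth-power site sum is at most `1024/δ⁶` (dyadic shells, tree:
`tsum_inv_pow_le_of_separated` with `k = 3`, `R = δ`). [folklore] -/
theorem tsum_inv_pow_six_site_le (hδ : 0 < δ) (hsep : ∀ a ∈ X, ∀ b ∈ X, a ≠ b → δ ≤ dist a b)
    {p : E3} (hp : p ∈ X) :
    ∑' q : {q : E3 // q ∈ X ∧ q ≠ p}, (dist p q.1)⁻¹ ^ 6 ≤ 1024 / (δ ^ 3 * δ ^ 3) := by
  have h := tsum_inv_pow_le_of_separated (X := X) p (k := 3) (by norm_num) hδ le_rfl hsep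
  have hcongr : ∑' q : {q : E3 // q ∈ X ∧ q ≠ p}, (dist p q.1)⁻¹ ^ 6 =
      ∑' q : {q : E3 // q ∈ X ∧ δ ≤ dist q p}, (dist (q : E3) p)⁻¹ ^ (3 + 3) := by
    have := tsum_congr_set_coe (fun q : E3 => (dist p q)⁻¹ ^ 6)
      (setOf_ne_eq_setOf_le_dist hδ hsep hp)
    simp only [dist_comm p] at this ⊢
    exact this
  rw [hcongr]
  exact h

/-- **Lower bound of a site sum by its repulsion at one neighbour.** For a `δ`-separated `X`,
`p ∈ X` and any other point `q ∈ X`: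
`(1/12)(dist p q)⁻¹² − (1/6)·1024/δ⁶ ≤ Σ'_{q' ∈ X, q' ≠ p} V_LJ(dist p q')`
(`V_LJ(d) = d⁻¹²/12 − d⁻⁶/6`, drop the other repulsions, bound the attractions by the
sixth-power site sum). [folklore] -/
theorem repulsion_sub_le_tsum_site (hδ : 0 < δ) (hsep : ∀ a ∈ X, ∀ b ∈ X, a ≠ b → δ ≤ dist a b)
    {p q : E3} (hp : p ∈ X) (hq : q ∈ X) (hqp : q ≠ p) :
    1 / 12 * (dist p q)⁻¹ ^ 12 - 1 / 6 * (1024 / (δ ^ 3 * δ ^ 3)) ≤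
      ∑' q' : {q' : E3 // q' ∈ X ∧ q' ≠ p}, lennardJones (dist p q'.1) := by
  set T := {q' : E3 // q' ∈ X ∧ q' ≠ p}
  have hV := summable_site hδ hsep hp
  have h6 := summable_inv_pow_six_site hδ hsep hp
  -- the repulsive family is summable: it is `V + (1/6) d⁻⁶`
  have h12 : Summable fun q' : T => 1 / 12 * (dist p q'.1)⁻¹ ^ 12 := by
    have := hV.add (h6.mul_left (1 / 6))
    convert this using 1
    funext q'
    simp only [lennardJones]
    ring
  have hdecomp : ∑' q' : T, lennardJones (dist p q'.1) =
      ∑' q' : T, 1 / 12 * (dist p q'.1)⁻¹ ^ 12 - ∑' q' : T, 1 / 6 * (dist p q'.1)⁻¹ ^ 6 := by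
    rw [← h12.tsum_sub (h6.mul_left (1 / 6))]
    exact tsum_congr fun _ => rfl
  -- one repulsive term bounds the repulsive sum from below
  have hrep : 1 / 12 * (dist p q)⁻¹ ^ 12 ≤ ∑' q' : T, 1 / 12 * (dist p q'.1)⁻¹ ^ 12 := by
    have := h12.le_tsum ⟨q, hq, hqp⟩ (fun j _ => by positivity)
    simpa using this
  -- the attractive sum is at most `(1/6)·1024/δ⁶`
  have hatt : ∑' q' : T, 1 / 6 * (dist p q'.1)⁻¹ ^ 6 ≤ 1 / 6 * (1024 / (δ ^ 3 * δ ^ 3)) := by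
    rw [tsum_mul_left]
    exact mul_le_mul_of_nonneg_left (tsum_inv_pow_six_site_le hδ hsep hp) (by norm_num)
  rw [hdecomp]
  linarith

end SiteSums

/-! ## §3 Absolute separation of uniformly bound sets -/

/-- **Absolute separation.** A uniformly discrete `X ⊆ ℝ³` all of whose Lennard-Jones site sums are
`≤ 0` (in particular a uniformly `2e*`-bound one, `2e* < 0`) is `1/4`-separated, whatever its own
separation constant: with `m = inf` of the mutual distances (`> 0`), `X` is `m`-separated, and at a pair
`a ≠ b` with `dist a b < 2^{1/12} m` the site sum at `a` is
`> (1/12)(2 m¹²)⁻¹ − (1/6)·1024 m⁻⁶ = (1 − 4096 m⁶)/(24 m¹²) ≥ 0` once `m < 1/4`. [folklore] -/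
theorem quarter_le_dist {X : Set E3}
    (hX : ∃ δ : ℝ, 0 < δ ∧ ∀ p ∈ X, ∀ q ∈ X, p ≠ q → δ ≤ dist p q)
    (hU : ∀ p ∈ X, ∑' q : {q : E3 // q ∈ X ∧ q ≠ p}, lennardJones (dist p q.1) ≤ 0) :
    ∀ p ∈ X, ∀ q ∈ X, p ≠ q → 1 / 4 ≤ dist p q := by
  obtain ⟨δ, hδ, hsep⟩ := hX
  by_contra hcon
  push Not at hcon
  obtain ⟨p₀, hp₀, q₀, hq₀, hne₀, hlt₀⟩ := hcon
  -- the infimum `m` of the mutual distances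
  set S : Set ℝ := {r | ∃ a ∈ X, ∃ b ∈ X, a ≠ b ∧ r = dist a b} with hS
  have hSne : S.Nonempty := ⟨dist p₀ q₀, p₀, hp₀, q₀, hq₀, hne₀, rfl⟩
  have hSbdd : BddBelow S := ⟨δ, by rintro r ⟨a, ha, b, hb, hab, rfl⟩; exact hsep a ha b hb hab⟩
  set m : ℝ := sInf S with hm
  have hδm : δ ≤ m := le_csInf hSne (by rintro r ⟨a, ha, b, hb, hab, rfl⟩; exact hsep a ha b hb hab)
  have hm0 : 0 < m := hδ.trans_le hδm
  have hmsep : ∀ a ∈ X, ∀ b ∈ X, a ≠ b → m ≤ dist a b := fun a ha b hb hab =>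
    csInf_le hSbdd ⟨a, ha, b, hb, hab, rfl⟩
  have hm4 : m < 1 / 4 := (csInf_le hSbdd ⟨p₀, hp₀, q₀, hq₀, hne₀, rfl⟩).trans_lt hlt₀
  -- a pair at distance `< 2^{1/12} m`
  set c : ℝ := (2 : ℝ) ^ ((1 : ℝ) / 12) with hc
  have hc1 : 1 < c := Real.one_lt_rpow (by norm_num) (by norm_num)
  have hc12 : c ^ 12 = 2 := by
    rw [show (c ^ 12 : ℝ) = c ^ ((12 : ℕ) : ℝ) from (Real.rpow_natCast c 12).symm, hc,
      ← Real.rpow_mul (by norm_num : (0 : ℝ) ≤ 2)]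
    norm_num
  have hmc : m < m * c := lt_mul_right hm0 hc1
  obtain ⟨r, ⟨a, ha, b, hb, hab, rfl⟩, hr⟩ := exists_lt_of_csInf_lt hSne (hm ▸ hmc)
  -- the site sum at `a`
  have hlow := repulsion_sub_le_tsum_site hm0 hmsep ha hb (Ne.symm hab)
  have hUa := hU a ha
  have hd0 : 0 < dist a b := hm0.trans_le (hmsep a ha b hb hab)
  have hd12 : (dist a b) ^ 12 < 2 * m ^ 12 := by
    calc (dist a b) ^ 12 < (m * c) ^ 12 := pow_lt_pow_left₀ hr dist_nonneg (by norm_num)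
      _ = 2 * m ^ 12 := by rw [mul_pow, hc12]; ring
  have hm6 : m ^ 6 < 1 / 4096 := by
    calc m ^ 6 < (1 / 4) ^ 6 := pow_lt_pow_left₀ hm4 hm0.le (by norm_num)
      _ = 1 / 4096 := by norm_num
  have hm12 : 0 < m ^ 12 := by positivity
  -- `(dist a b)⁻¹² > 1/(2 m¹²)` and `1024/(6 m⁶) < 1/(24 m¹²)`
  have hinv : (2 * m ^ 12)⁻¹ < (dist a b)⁻¹ ^ 12 := by
    rw [inv_pow]
    exact (inv_lt_inv₀ (by positivity) (by positivity)).2 hd12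
  have hkey : 1 / 6 * (1024 / (m ^ 3 * m ^ 3)) < 1 / 12 * (2 * m ^ 12)⁻¹ := by
    rw [show m ^ 3 * m ^ 3 = m ^ 6 by ring]
    rw [show (1 : ℝ) / 6 * (1024 / m ^ 6) = 1024 / (6 * m ^ 6) by field_simp]
    rw [show (1 : ℝ) / 12 * (2 * m ^ 12)⁻¹ = 1 / (24 * m ^ 12) by field_simp; ring]
    rw [div_lt_div_iff₀ (by positivity) (by positivity)]
    have : m ^ 12 = m ^ 6 * m ^ 6 := by ring
    nlinarith [mul_lt_mul_of_pos_left hm6 (pow_pos hm0 6)]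
  linarith

/-! ## §4 Nearest points and touching empty balls -/

section Nearest

variable {X : Set E3} {δ : ℝ}

/-- Bounded parts of a separated set are finite (tree:
`finite_of_forall_le_dist_of_subset_closedBall`). [folklore] -/
theorem finite_sep_ball (hδ : 0 < δ) (hsep : ∀ a ∈ X, ∀ b ∈ X, a ≠ b → δ ≤ dist a b)
    (c : E3) (R : ℝ) : ({q : E3 | q ∈ X ∧ dist q c ≤ R} : Set E3).Finite :=
  finite_of_forall_le_dist_of_subset_closedBall hδ
    (fun p hp q hq hpq => hsep p hp.1 q hq.1 hpq) (c := c) (R := R)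
    (fun _ hp => mem_closedBall.2 hp.2)

/-- **Nearest points exist**: for a non-empty separated `X` and any `y`, some `p ∈ X` minimises
`dist y ·` over `X` (minimise over the finitely many points not farther than a given one). [folklore] -/
theorem exists_forall_dist_le (hδ : 0 < δ) (hsep : ∀ a ∈ X, ∀ b ∈ X, a ≠ b → δ ≤ dist a b)
    (hne : X.Nonempty) (y : E3) : ∃ p ∈ X, ∀ q ∈ X, dist y p ≤ dist y q := by
  obtain ⟨p₀, hp₀⟩ := hne
  have hfin := finite_sep_ball hδ hsep y (dist p₀ y)
  have hne' : hfin.toFinset.Nonempty :=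
    ⟨p₀, by rw [Set.Finite.mem_toFinset]; exact ⟨hp₀, le_rfl⟩⟩
  obtain ⟨p, hp, hmin⟩ := hfin.toFinset.exists_min_image (fun q => dist y q) hne'
  rw [Set.Finite.mem_toFinset] at hp
  refine ⟨p, hp.1, fun q hq => ?_⟩
  by_cases h : dist q y ≤ dist p₀ y
  · exact hmin q (by rw [Set.Finite.mem_toFinset]; exact ⟨hq, h⟩)
  · push Not at h
    calc dist y p ≤ dist y p₀ := hmin p₀ (by rw [Set.Finite.mem_toFinset]; exact ⟨hp₀, le_rfl⟩)
      _ = dist p₀ y := dist_comm _ _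
      _ ≤ dist q y := h.le
      _ = dist y q := dist_comm _ _

/-- **Large holes give large touching empty balls.** If a non-empty separated `X` is NOT relatively
dense, then for every `ρ` there are a centre `y` and a point `p ∈ X` nearest to `y` with
`dist y p ≥ ρ`: the open ball of radius `dist y p ≥ ρ` about `y` misses `X` and has `p` on its
boundary. [folklore] -/
theorem exists_touching (hδ : 0 < δ) (hsep : ∀ a ∈ X, ∀ b ∈ X, a ≠ b → δ ≤ dist a b)
    (hne : X.Nonempty) (h : ¬ ∃ R : ℝ, ∀ y : E3, ∃ p ∈ X, dist y p ≤ R) (ρ : ℝ) :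
    ∃ y p : E3, p ∈ X ∧ ρ ≤ dist y p ∧ ∀ q ∈ X, dist y p ≤ dist y q := by
  push Not at h
  obtain ⟨y, hy⟩ := h ρ
  obtain ⟨p, hp, hmin⟩ := exists_forall_dist_le hδ hsep hne y
  exact ⟨y, p, hp, (hy p hp).le, hmin⟩

end Nearest

/-! ## Registered sub-goal of `stub_cohesion`: absolute separation -/

/-- **Sub-goal `stub_cohesion_absoluteSeparation` of the stub `stub_cohesion`** (registered on
stmt-AtomisticToContinuum-15099): every uniformly discrete, uniformly `2e*`-bound `X ⊆ ℝ³` is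
`1/4`-separated (`quarter_le_dist` with `2e* < 0`, `two_mul_iInf_lt_zero`). [folklore] -/
theorem stub_cohesion_absoluteSeparation :
    ∀ X : Set (EuclideanSpace ℝ (Fin 3)),
      (∃ δ : ℝ, 0 < δ ∧ ∀ p ∈ X, ∀ q ∈ X, p ≠ q → δ ≤ dist p q) →
      (∀ p ∈ X, ∑' q : {q : EuclideanSpace ℝ (Fin 3) // q ∈ X ∧ q ≠ p},
          lennardJones (dist p q.1) ≤
        2 * ⨅ Q : PeriodicConfiguration 3, Q.energyPerParticle lennardJones) →
      ∀ p ∈ X, ∀ q ∈ X, p ≠ q → 1 / 4 ≤ dist p q :=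
  fun _ hX hU => quarter_le_dist hX fun p hp => (hU p hp).trans two_mul_iInf_lt_zero.le

end Summit.AtomisticToContinuum.Crystallization.Theorems.PerronTransitivityUniformBindingRigidity

end
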